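import Summits.AtomisticToContinuum.Crystallization.Theorems.PhononSlackCertificatesPeriodicGivenLayeredExtraction2
import Literature.MathematicalPhysics.StatisticalMechanics.BarlowStackingEnergy

/-!
# Crux `PeriodicWindows` (stmt-AtomisticToContinuum-3240), line `Sketch` — stub E1: one rotated Barlow
# stacking in the hull

Stub `stub_barlowHullPoint` of the lead skeleton `PeriodicWindowsSketch` (rev 9, route
`ChessboardParticlePlanes`), pure compactness (no hypothesis on the configurations `x N`): if for every
`R > 0` and `ε ∈ (0, 1/4)`, frequently in `N`, some particle `i` of `x N` has an `(R, ε)`-window matched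
(via `p ↦ x_i + A (p - z)`, `A` a linear isometry, `z` a stacking point) to SOME Barlow stacking
`barlowStacking a h s` (`a, h ∈ (1/2, 2)`, `s` a Hägg sequence), then ONE rotated Barlow stacking
`A '' barlowStacking a h s` (`a, h ∈ [1/2, 2]`) is two-way matched on every ball `‖·‖ ≤ R` by translates
`x N + t`, frequently in `N`.

Proof (the template is `LayeredHull.stub_extraction` of `…PeriodicGivenLayeredExtraction`).

1. RE-CENTRE each window at its stacking point `z = barlowPos a h s k₀ i₀ j₀`: by the re-indexing identity
   `barlowPos a h s k i j - z = barlowPos a h (s (· + k₀)) (k - k₀) (i - i₀) (j - j₀)` (`bhp_barlowPos_sub`,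
   from `barlowPos_sub_barlowPos` and `LayeredHull.ext_haggLabel_shift`), the window says that
   `x N + (-x N i)` is two-way `ε`-matched with `A '' barlowStacking a h (s (· + k₀))` on `‖·‖ ≤ R`
   (`bhp_recentre`).
2. DIAGONAL: windows at scale `(k + 1, 1/(k + 5))` along `φ : ℕ → ℕ` strictly increasing
   (`Filter.extraction_forall_of_frequently`).
3. COMPACTNESS: the data `(A_k, s_k, a_k, h_k)` live in `Isom(ℝ³) × {±1}^ℤ × [1/2, 2]²`
   (`LayeredHull.ext_isCompact_isometries`, `LayeredHull.ext_isCompact_words`, `isCompact_Icc`); take a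
   cluster point `(A₀, s₀, a₀, h₀)`.
4. CLOSENESS: a stacking point `barlowPos a h s m i j` of norm `≤ R + 1` has `|m| ≤ 2 (R + 1)` (`h ≥ 1/2`);
   if `s' = s` on `|m| ≤ M ⊇ [-2(R+1), 2(R+1)]`, `|a - a'|, |h - h'| ≤ κ/2` and `‖A - A'‖ ≤ κ` with
   `κ (R + 2) = η/4`, the point with the same indices of `A' '' barlowStacking a' h' s'` is within `η/2`
   (`bhp_close_points`: `layerVec` is linear in `(a, h)`, `bhp_norm_layerVec_sub_le`). Then
   `LayeredHull.ext_match_mono` / `LayeredHull.ext_match_perturb` transfer a fine window of the `k`-th data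
   (`k` large, data near the cluster point) to an `(R, ε)`-window for the limit stacking.
-/

noncomputable section

namespace Summit.AtomisticToContinuum.Crystallization.Theorems.PeriodicWindowsSketch

open Literature.MathematicalPhysics.StatisticalMechanics Filter Topology

/-! ## Re-centring a window at a stacking point -/

/-- **Re-indexing identity.** Seen from its point `z = barlowPos a h s k₀ i₀ j₀`, a Barlow stacking is the
Barlow stacking of the shifted Hägg sequence `s (· + k₀)`:
`barlowPos a h s k i j - z = barlowPos a h (s (· + k₀)) (k - k₀) (i - i₀) (j - j₀)`. [folklore] -/
theorem bhp_barlowPos_sub (a h : ℝ) (s : ℤ → ℤ) (k₀ i₀ j₀ k i j : ℤ) :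
    barlowPos a h s k i j - barlowPos a h s k₀ i₀ j₀ =
      barlowPos a h (fun m => s (m + k₀)) (k - k₀) (i - i₀) (j - j₀) := by
  rw [barlowPos_sub_barlowPos]
  simp only [barlowPos, layerVec, LayeredHull.ext_haggLabel_shift s k₀, sub_add_cancel]

/-- **Re-centring a window.** An `(R, ε)`-window of particle `i` matched via `p ↦ y i + A (p - z)` to
`barlowStacking a h s`, `z` a stacking point, is a two-way `ε`-match on `‖·‖ ≤ R` of the translate
`y + (-y i)` with the rotated stacking `A '' barlowStacking a h s'` of a shifted Hägg sequence `s'`.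
[folklore] -/
theorem bhp_recentre {N : ℕ} (y : Fin N → EuclideanSpace ℝ (Fin 3)) (i : Fin N) {a h R ε : ℝ}
    {s : ℤ → ℤ} (hs : IsHaggSeq s) {z : EuclideanSpace ℝ (Fin 3)} (hz : z ∈ barlowStacking a h s)
    (A : EuclideanSpace ℝ (Fin 3) →ₗᵢ[ℝ] EuclideanSpace ℝ (Fin 3))
    (h1 : ∀ p ∈ barlowStacking a h s, dist p z ≤ R → ∃ j : Fin N, dist (y j) (y i + A (p - z)) ≤ ε)
    (h2 : ∀ j : Fin N, dist (y j) (y i) ≤ R →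
      ∃ p ∈ barlowStacking a h s, dist (y j) (y i + A (p - z)) ≤ ε) :
    ∃ (s' : ℤ → ℤ) (t : EuclideanSpace ℝ (Fin 3)), IsHaggSeq s' ∧
      (∀ q ∈ A '' barlowStacking a h s', ‖q‖ ≤ R → ∃ j : Fin N, dist (y j + t) q ≤ ε) ∧
      (∀ j : Fin N, ‖y j + t‖ ≤ R → ∃ q ∈ A '' barlowStacking a h s', dist (y j + t) q ≤ ε) := by
  obtain ⟨k₀, i₀, j₀, rfl⟩ := hz
  have hdist : ∀ (j : Fin N) (v : EuclideanSpace ℝ (Fin 3)),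
      dist (y j + -y i) v = dist (y j) (y i + v) := fun j v => by
    rw [dist_eq_norm, dist_eq_norm]
    congr 1
    abel
  refine ⟨fun m => s (m + k₀), -y i, fun m => hs (m + k₀), ?_, fun j hj => ?_⟩
  · rintro q ⟨p', ⟨k, i', j', rfl⟩, rfl⟩ hq
    have hp : barlowPos a h s (k + k₀) (i' + i₀) (j' + j₀) - barlowPos a h s k₀ i₀ j₀ =
        barlowPos a h (fun m => s (m + k₀)) k i' j' := by
      rw [bhp_barlowPos_sub]
      simp only [add_sub_cancel_right]
    obtain ⟨j, hj⟩ := h1 _ (barlowPos_mem (k + k₀) (i' + i₀) (j' + j₀))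
      (by rw [dist_eq_norm, hp]; rwa [A.norm_map] at hq)
    exact ⟨j, by rwa [hdist, ← hp]⟩
  · obtain ⟨p, ⟨k, i', j', rfl⟩, hd⟩ := h2 j (by rwa [dist_eq_norm, sub_eq_add_neg])
    refine ⟨A (barlowPos a h s k i' j' - barlowPos a h s k₀ i₀ j₀), ⟨_, ?_, rfl⟩, by rwa [hdist]⟩
    rw [bhp_barlowPos_sub]
    exact barlowPos_mem _ _ _

/-! ## Perturbing the data of a rotated Barlow stacking -/

/-- `layerVec a h δ k i j` is linear in the spacings `(a, h)`. [folklore] -/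
theorem bhp_layerVec_sub (a h a' h' : ℝ) (δ k i j : ℤ) :
    layerVec a h δ k i j - layerVec a' h' δ k i j = layerVec (a - a') (h - h') δ k i j := by
  ext l
  fin_cases l <;> simp <;> ring

/-- **Relative perturbation of the spacings.** For `a, h ≥ 1/2` and `|a - a'|, |h - h'| ≤ κ/2`
(`κ ≥ 0`), every `layerVec` moves by at most `κ` times its norm when `(a, h)` is replaced by `(a', h')`
(coordinate-wise comparison in `norm_layerVec`). [folklore] -/
theorem bhp_norm_layerVec_sub_le {a h a' h' κ : ℝ} (ha : 1 / 2 ≤ a) (hh : 1 / 2 ≤ h) (hκ : 0 ≤ κ)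
    (haa' : |a - a'| ≤ κ / 2) (hhh' : |h - h'| ≤ κ / 2) (δ k i j : ℤ) :
    ‖layerVec a h δ k i j - layerVec a' h' δ k i j‖ ≤ κ * ‖layerVec a h δ k i j‖ := by
  rw [bhp_layerVec_sub, norm_layerVec, norm_layerVec, ← Real.sqrt_sq hκ, ← Real.sqrt_mul (sq_nonneg κ)]
  apply Real.sqrt_le_sqrt
  have h1 : (a - a') ^ 2 ≤ κ ^ 2 * a ^ 2 := by
    have hb : |a - a'| ≤ κ * a := haa'.trans (by nlinarith)
    rw [← mul_pow]
    exact sq_le_sq' (abs_le.1 hb).1 (abs_le.1 hb).2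
  have h2 : (h - h') ^ 2 ≤ κ ^ 2 * h ^ 2 := by
    have hb : |h - h'| ≤ κ * h := hhh'.trans (by nlinarith)
    rw [← mul_pow]
    exact sq_le_sq' (abs_le.1 hb).1 (abs_le.1 hb).2
  have t1 := mul_le_mul_of_nonneg_right h1 (sq_nonneg ((i : ℝ) + j / 2 + δ / 2))
  have t2 := mul_le_mul_of_nonneg_right h1 (sq_nonneg (√3 / 2 * ((j : ℝ) + δ / 3)))
  have t3 := mul_le_mul_of_nonneg_right h2 (sq_nonneg (k : ℝ))
  nlinarith [t1, t2, t3]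

/-- **Perturbing the data moves the points in a ball by little.** Let `a, h ≥ 1/2`,
`2 (R + 1) ≤ M`, `κ ≥ 0` with `κ (R + 1) ≤ η/4`. If `|a - a'|, |h - h'| ≤ κ/2`, the Hägg sequences
`s, s'` agree on `|m| ≤ M` and the linear isometries `A, A'` differ by `≤ η/4` on `‖·‖ ≤ R + 1`, then
every point of `A '' barlowStacking a h s` of norm `≤ R + 1` is within `η/2` of
`A' '' barlowStacking a' h' s'` (the point with the same indices: its layer index has `|m| ≤ M` since
the height `m h` is at most the norm, so the labels agree, `LayeredHull.ext_haggLabel_eq_of_eqOn`).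
[folklore] -/
theorem bhp_close_points {a h a' h' R η κ : ℝ} {M : ℕ} (ha : 1 / 2 ≤ a) (hh : 1 / 2 ≤ h)
    (A A' : EuclideanSpace ℝ (Fin 3) →ₗᵢ[ℝ] EuclideanSpace ℝ (Fin 3)) (s s' : ℤ → ℤ)
    (hM : 2 * (R + 1) ≤ M) (hκ : 0 ≤ κ) (hκR : κ * (R + 1) ≤ η / 4)
    (haa' : |a - a'| ≤ κ / 2) (hhh' : |h - h'| ≤ κ / 2)
    (hss' : ∀ m : ℤ, |m| ≤ M → s m = s' m)
    (hAA' : ∀ v : EuclideanSpace ℝ (Fin 3), ‖v‖ ≤ R + 1 → ‖A v - A' v‖ ≤ η / 4) :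
    ∀ p ∈ A '' barlowStacking a h s, ‖p‖ ≤ R + 1 →
      ∃ p' ∈ A' '' barlowStacking a' h' s', dist p p' ≤ η / 2 := by
  rintro p ⟨q, ⟨m, i, j, rfl⟩, rfl⟩ hp
  rw [A.norm_map] at hp
  have hm : |m| ≤ (M : ℤ) := by
    have h2 := PiLp.norm_apply_le (barlowPos a h s m i j) 2
    rw [barlowPos_apply_two, Real.norm_eq_abs, abs_mul,
      abs_of_nonneg (by linarith : (0 : ℝ) ≤ h)] at h2
    have h3 : |(m : ℝ)| * (1 / 2) ≤ |(m : ℝ)| * h := mul_le_mul_of_nonneg_left hh (abs_nonneg _)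
    have h4 : |(m : ℝ)| ≤ M := by linarith
    exact_mod_cast h4
  have hL : haggLabel s m = haggLabel s' m := LayeredHull.ext_haggLabel_eq_of_eqOn hss' m hm
  refine ⟨A' (barlowPos a' h' s' m i j), ⟨_, barlowPos_mem _ _ _, rfl⟩, ?_⟩
  have hqq' : ‖barlowPos a h s m i j - barlowPos a' h' s' m i j‖ ≤ η / 4 := by
    have key := bhp_norm_layerVec_sub_le ha hh hκ haa' hhh' (haggLabel s m) m i j
    have e1 : barlowPos a h s m i j = layerVec a h (haggLabel s m) m i j := rfl
    have e2 : barlowPos a' h' s' m i j = layerVec a' h' (haggLabel s m) m i j := by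
      simp only [barlowPos, layerVec, hL]
    rw [e1, e2] at *
    calc ‖layerVec a h (haggLabel s m) m i j - layerVec a' h' (haggLabel s m) m i j‖
        ≤ κ * ‖layerVec a h (haggLabel s m) m i j‖ := key
      _ ≤ κ * (R + 1) := mul_le_mul_of_nonneg_left hp hκ
      _ ≤ η / 4 := hκR
  calc dist (A (barlowPos a h s m i j)) (A' (barlowPos a' h' s' m i j))
      ≤ dist (A (barlowPos a h s m i j)) (A' (barlowPos a h s m i j)) +
          dist (A' (barlowPos a h s m i j)) (A' (barlowPos a' h' s' m i j)) := dist_triangle _ _ _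
    _ ≤ η / 4 + η / 4 := by
        refine add_le_add ?_ ?_
        · rw [dist_eq_norm]
          exact hAA' _ hp
        · rw [dist_eq_norm, ← A'.map_sub, A'.norm_map]
          exact hqq'
    _ = η / 2 := by ring

/-! ## The stub -/

/-- **Stub E1 of line `Sketch` (crux `PeriodicWindows`, stmt-AtomisticToContinuum-3240): one exact rotated
Barlow stacking in the hull.** If for every `R > 0` and `ε ∈ (0, 1/4)`, frequently in `N`, some particle
`i` of `x N` has an `(R, ε)`-window matched (after `p ↦ x_i + A (p - z)`) to some `barlowStacking a h s`
with `a, h ∈ (1/2, 2)`, then ONE rotated Barlow stacking `A '' barlowStacking a h s` (`a, h ∈ [1/2, 2]`,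
`s` Hägg, `A` a linear isometry) is two-way matched on every ball `‖·‖ ≤ R` by translates of `x N`,
frequently in `N`. Proof: re-centre the windows (`bhp_recentre`), diagonal sequence of
`(k + 1, 1/(k + 5))`-windows (`Filter.extraction_forall_of_frequently`), cluster point of the data in the
compact `Isom(ℝ³) × {±1}^ℤ × [1/2, 2]²` (`IsCompact.exists_mapClusterPt`), transfer of far-out windows with
data near the cluster point (`bhp_close_points`, `LayeredHull.ext_match_perturb`). [folklore] -/
theorem stub_barlowHullPoint (x : (N : ℕ) → (Fin N → EuclideanSpace ℝ (Fin 3)))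
    (hW : ∀ R ε : ℝ, 0 < R → 0 < ε → ε < 1 / 4 → ∃ᶠ N in Filter.atTop, ∃ (i : Fin N) (a h : ℝ),
      1 / 2 < a ∧ a < 2 ∧ 1 / 2 < h ∧ h < 2 ∧ ∃ s : ℤ → ℤ, IsHaggSeq s ∧ ∃ z ∈ barlowStacking a h s,
        ∃ A : EuclideanSpace ℝ (Fin 3) →ₗᵢ[ℝ] EuclideanSpace ℝ (Fin 3),
          (∀ p ∈ barlowStacking a h s, dist p z ≤ R → ∃ j : Fin N, dist (x N j) (x N i + A (p - z)) ≤ ε) ∧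
          (∀ j : Fin N, dist (x N j) (x N i) ≤ R →
            ∃ p ∈ barlowStacking a h s, dist (x N j) (x N i + A (p - z)) ≤ ε)) :
    ∃ (a h : ℝ) (s : ℤ → ℤ) (A : EuclideanSpace ℝ (Fin 3) →ₗᵢ[ℝ] EuclideanSpace ℝ (Fin 3)),
      1 / 2 ≤ a ∧ a ≤ 2 ∧ 1 / 2 ≤ h ∧ h ≤ 2 ∧ IsHaggSeq s ∧
      ∀ R ε : ℝ, 0 < ε → ∃ᶠ N in Filter.atTop, ∃ t : EuclideanSpace ℝ (Fin 3),
        (∀ p ∈ A '' barlowStacking a h s, ‖p‖ ≤ R → ∃ i : Fin N, dist (x N i + t) p ≤ ε) ∧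
        (∀ i : Fin N, ‖x N i + t‖ ≤ R → ∃ p ∈ A '' barlowStacking a h s, dist (x N i + t) p ≤ ε) := by
  -- Step 1: re-centred windows at scale `(k + 1, 1/(k + 5))`, frequently in `N`, along a diagonal sequence
  have h1 : ∀ k : ℕ, ∃ᶠ N in atTop, ∃ (a h : ℝ) (s : ℤ → ℤ)
      (A : EuclideanSpace ℝ (Fin 3) →ₗᵢ[ℝ] EuclideanSpace ℝ (Fin 3)) (t : EuclideanSpace ℝ (Fin 3)),
      (1 / 2 ≤ a ∧ a ≤ 2) ∧ (1 / 2 ≤ h ∧ h ≤ 2) ∧ IsHaggSeq s ∧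
      (∀ q ∈ A '' barlowStacking a h s, ‖q‖ ≤ (k : ℝ) + 1 →
        ∃ j : Fin N, dist (x N j + t) q ≤ 1 / ((k : ℝ) + 5)) ∧
      (∀ j : Fin N, ‖x N j + t‖ ≤ (k : ℝ) + 1 →
        ∃ q ∈ A '' barlowStacking a h s, dist (x N j + t) q ≤ 1 / ((k : ℝ) + 5)) := by
    intro k
    have hk4 : 1 / ((k : ℝ) + 5) < 1 / 4 := by
      rw [one_div_lt_one_div (by positivity) (by norm_num)]
      have : (0 : ℝ) ≤ k := k.cast_nonneg
      linarith
    refine (hW ((k : ℝ) + 1) (1 / ((k : ℝ) + 5)) (by positivity) (by positivity) hk4).mono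
      fun N hN => ?_
    obtain ⟨i, a, h, ha1, ha2, hh1, hh2, s, hs, z, hz, A, hA1, hA2⟩ := hN
    obtain ⟨s', t, hs', hM1, hM2⟩ := bhp_recentre (x N) i hs hz A hA1 hA2
    exact ⟨a, h, s', A, t, ⟨ha1.le, ha2.le⟩, ⟨hh1.le, hh2.le⟩, hs', hM1, hM2⟩
  obtain ⟨φ, hφ, hφW⟩ := extraction_forall_of_frequently h1
  choose a hg s A t ha hhg hs hM using hφW
  -- Step 2: a cluster point of the data in the compact data space
  have hKc := LayeredHull.ext_isCompact_isometries.prod (LayeredHull.ext_isCompact_words.prod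
    ((isCompact_Icc : IsCompact (Set.Icc (1 / 2 : ℝ) 2)).prod
      (isCompact_Icc : IsCompact (Set.Icc (1 / 2 : ℝ) 2))))
  have hdK : ∀ k, ((A k).toContinuousLinearMap, s k, a k, hg k) ∈
      {L : EuclideanSpace ℝ (Fin 3) →L[ℝ] EuclideanSpace ℝ (Fin 3) | ∀ v, ‖L v‖ = ‖v‖} ×ˢ
        ((Set.pi Set.univ fun _ : ℤ => ({1, -1} : Set ℤ)) ×ˢ
          (Set.Icc (1 / 2 : ℝ) 2 ×ˢ Set.Icc (1 / 2 : ℝ) 2)) := fun k =>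
    Set.mk_mem_prod (fun v => (A k).norm_map v) (Set.mk_mem_prod
      (Set.mem_univ_pi.2 fun i => by rcases hs k i with h | h <;> simp [h])
      (Set.mk_mem_prod (ha k) (hhg k)))
  obtain ⟨⟨L₀, s₀, a₀, h₀⟩, hmem, hcl⟩ := hKc.exists_mapClusterPt (f := atTop)
    (u := fun k => ((A k).toContinuousLinearMap, s k, a k, hg k))
    (tendsto_principal.2 (Eventually.of_forall hdK))
  have hL₀ : ∀ v, ‖L₀ v‖ = ‖v‖ := hmem.1
  have hs₀ : IsHaggSeq s₀ := fun i => by simpa using Set.mem_univ_pi.1 hmem.2.1 i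
  have ha₀ : 1 / 2 ≤ a₀ ∧ a₀ ≤ 2 := hmem.2.2.1
  have hh₀ : 1 / 2 ≤ h₀ ∧ h₀ ≤ 2 := hmem.2.2.2
  rw [mapClusterPt_iff_frequently] at hcl
  let A₀ : EuclideanSpace ℝ (Fin 3) →ₗᵢ[ℝ] EuclideanSpace ℝ (Fin 3) :=
    ⟨(L₀ : EuclideanSpace ℝ (Fin 3) →ₗ[ℝ] EuclideanSpace ℝ (Fin 3)), hL₀⟩
  have hA₀ : ∀ v, A₀ v = L₀ v := fun v => rfl
  refine ⟨a₀, h₀, s₀, A₀, ha₀.1, ha₀.2, hh₀.1, hh₀.2, hs₀, ?_⟩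
  intro R ε hε
  -- Step 3: parameters for the target scale `(R, ε)`
  obtain ⟨η, hη0, hηε, hη1⟩ : ∃ η : ℝ, 0 < η ∧ η ≤ ε ∧ η ≤ 1 :=
    ⟨min ε 1, lt_min hε one_pos, min_le_left _ _, min_le_right _ _⟩
  obtain ⟨R', hR'0, hRR'⟩ : ∃ R' : ℝ, 0 ≤ R' ∧ R ≤ R' := ⟨max R 0, le_max_right _ _, le_max_left _ _⟩
  obtain ⟨M, hMR⟩ : ∃ M : ℕ, 2 * (R' + 1) ≤ M := exists_nat_ge _
  obtain ⟨k₀, hk₀R, hk₀η⟩ : ∃ k₀ : ℕ, R' ≤ k₀ ∧ 1 / ((k₀ : ℝ) + 5) ≤ η / 2 := by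
    obtain ⟨k₀, hk₀⟩ := exists_nat_ge (max R' (2 / η))
    refine ⟨k₀, (le_max_left _ _).trans hk₀, ?_⟩
    have h2 : 2 / η ≤ k₀ := (le_max_right _ _).trans hk₀
    rw [div_le_iff₀ hη0] at h2
    rw [div_le_iff₀ (by positivity)]
    nlinarith
  obtain ⟨κ, hκ0, hκ2⟩ : ∃ κ : ℝ, 0 < κ ∧ κ * (R' + 2) = η / 4 :=
    ⟨η / (4 * (R' + 2)), by positivity, by field_simp⟩
  have hκR : κ * (R' + 1) ≤ η / 4 := by nlinarith
  -- Step 4: the neighbourhood of the cluster point adapted to `(R', η, M)`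
  have hU : ∀ᶠ e in 𝓝 ((L₀, s₀, a₀, h₀) :
      (EuclideanSpace ℝ (Fin 3) →L[ℝ] EuclideanSpace ℝ (Fin 3)) × ((ℤ → ℤ) × (ℝ × ℝ))),
      dist e.1 L₀ ≤ κ ∧ (∀ m ∈ Finset.Icc (-(M : ℤ)) M, e.2.1 m = s₀ m) ∧
        dist e.2.2.1 a₀ ≤ κ / 2 ∧ dist e.2.2.2 h₀ ≤ κ / 2 := by
    refine Eventually.and ?_ (Eventually.and ?_ (Eventually.and ?_ ?_))
    · have h1 : ∀ᶠ y in 𝓝 L₀, dist y L₀ ≤ κ := Metric.closedBall_mem_nhds L₀ hκ0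
      exact (continuous_fst.tendsto (L₀, s₀, a₀, h₀)).eventually h1
    · refine (eventually_all_finset _).2 fun m _ => ?_
      have hc : Continuous fun e : (EuclideanSpace ℝ (Fin 3) →L[ℝ] EuclideanSpace ℝ (Fin 3)) ×
          ((ℤ → ℤ) × (ℝ × ℝ)) => e.2.1 m :=
        (continuous_apply m).comp (continuous_fst.comp continuous_snd)
      exact (hc.tendsto (L₀, s₀, a₀, h₀)).eventually
        (show ∀ᶠ y in 𝓝 (s₀ m), y = s₀ m by simp [nhds_discrete])
    · have h1 : ∀ᶠ y in 𝓝 a₀, dist y a₀ ≤ κ / 2 := Metric.closedBall_mem_nhds a₀ (by positivity)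
      have hc : Continuous fun e : (EuclideanSpace ℝ (Fin 3) →L[ℝ] EuclideanSpace ℝ (Fin 3)) ×
          ((ℤ → ℤ) × (ℝ × ℝ)) => e.2.2.1 :=
        continuous_fst.comp (continuous_snd.comp continuous_snd)
      exact (hc.tendsto (L₀, s₀, a₀, h₀)).eventually h1
    · have h1 : ∀ᶠ y in 𝓝 h₀, dist y h₀ ≤ κ / 2 := Metric.closedBall_mem_nhds h₀ (by positivity)
      have hc : Continuous fun e : (EuclideanSpace ℝ (Fin 3) →L[ℝ] EuclideanSpace ℝ (Fin 3)) ×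
          ((ℤ → ℤ) × (ℝ × ℝ)) => e.2.2.2 :=
        continuous_snd.comp (continuous_snd.comp continuous_snd)
      exact (hc.tendsto (L₀, s₀, a₀, h₀)).eventually h1
  have hfr := hcl _ hU
  -- Step 5: a window far out in the diagonal sequence whose data lie in the neighbourhood
  rw [frequently_atTop]
  intro Nmin
  have hev : ∀ᶠ k in atTop, k₀ ≤ k ∧ Nmin ≤ φ k :=
    (eventually_ge_atTop k₀).and (hφ.tendsto_atTop.eventually_ge_atTop Nmin)
  obtain ⟨k, hkU, hk₀, hkN⟩ := (hfr.and_eventually hev).exists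
  refine ⟨φ k, hkN, t k, ?_⟩
  simp only [Set.mem_setOf_eq] at hkU
  obtain ⟨hkA, hks, hka, hkh⟩ := hkU
  -- closeness of the data
  have hss : ∀ m : ℤ, |m| ≤ M → s k m = s₀ m := fun m hm =>
    hks m (Finset.mem_Icc.2 (abs_le.1 hm))
  have haa : |a k - a₀| ≤ κ / 2 := by rwa [← Real.dist_eq]
  have hhh : |hg k - h₀| ≤ κ / 2 := by rwa [← Real.dist_eq]
  have hAA : ∀ v : EuclideanSpace ℝ (Fin 3), ‖v‖ ≤ R' + 1 → ‖A k v - A₀ v‖ ≤ η / 4 := by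
    intro v hv
    rw [hA₀, show A k v - L₀ v = ((A k).toContinuousLinearMap - L₀) v from rfl]
    rw [dist_eq_norm] at hkA
    calc ‖((A k).toContinuousLinearMap - L₀) v‖ ≤ ‖(A k).toContinuousLinearMap - L₀‖ * ‖v‖ :=
          ContinuousLinearMap.le_opNorm _ _
      _ ≤ κ * (R' + 1) := mul_le_mul hkA hv (norm_nonneg _) hκ0.le
      _ ≤ η / 4 := hκR
  -- Step 6: transfer the match from the `k`-th stacking to the limit stacking
  have hmk := hM k
  have hkR : R' + 1 ≤ (k : ℝ) + 1 := by
    have : (k₀ : ℝ) ≤ k := by exact_mod_cast hk₀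
    linarith
  have hkη : 1 / ((k : ℝ) + 5) ≤ η / 2 := by
    refine le_trans (one_div_le_one_div_of_le (by positivity) ?_) hk₀η
    have : (k₀ : ℝ) ≤ k := by exact_mod_cast hk₀
    linarith
  have h2 := LayeredHull.ext_match_mono (x (φ k)) (t k) _ hkR hkη hmk
  have h3 := LayeredHull.ext_match_perturb (x (φ k)) (t k) _ (A₀ '' barlowStacking a₀ h₀ s₀) hη1
    (bhp_close_points (ha k).1 (hhg k).1 (A k) A₀ (s k) s₀ hMR hκ0.le hκR haa hhh hss hAA)
    (bhp_close_points ha₀.1 hh₀.1 A₀ (A k) s₀ (s k) hMR hκ0.le hκR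
      (by rw [abs_sub_comm]; exact haa) (by rw [abs_sub_comm]; exact hhh)
      (fun m hm => (hss m hm).symm) (fun v hv => by rw [norm_sub_rev]; exact hAA v hv)) h2
  exact LayeredHull.ext_match_mono (x (φ k)) (t k) _ hRR' hηε h3

end Summit.AtomisticToContinuum.Crystallization.Theorems.PeriodicWindowsSketch

end
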